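import Literature.Computability.AlgebraicComplexity.LayeredABPInvRepr
import HarnessLib

/-!
# Layered algebraic branching programs: affine substitution and restriction of scalars
# (regular-representation unrolling of a program over a finite free coefficient algebra)

Two closure properties of the tree's `LayeredABPComputes` (Andrews–Forbes 2022 §3.2 rendering of
layered ABPs: vertex set `Fin k`, `k ≤ m`, a layer function, an adjacency matrix `N` of affine
labels every edge of which raises the layer by one, computed polynomial `(N ^ (ℓ(t) − ℓ(s))) s t`):

* `LayeredABPComputes.aeval_affine` — substituting affine forms for the variables keeps the
  program (same graph, relabelled edges): `LayeredABPComputes m g → LayeredABPComputes m (aeval φ g)`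
  when every `φ i` has total degree `≤ 1`.
* `LayeredABPComputes.restrictScalars` — **regular-representation unrolling** (the accounting of
  Hrubeš–Yehudayoff 2011 for arithmetic computations over a ring extension `R ⊇ F` that is a free
  `F`-module of rank `r`: "simulate the arithmetic of `R` by `r × r` matrices over `F`", Thm. 1.1 /
  §4 there, cost factor polynomial in `r`; for branching programs the simulation is exact vertex by
  vertex): if `P ∈ R[x]` is computed by a layered program on `≤ m` vertices over `R`, `b` is an
  `F`-basis of `R` indexed by `β` and `λ : R → F` is `F`-linear, then `λ` applied coefficientwise to
  `P` is computed by a layered program on `≤ m · |β| + 2` vertices over `F`. Construction: every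
  vertex `v` becomes the block `{v} × β`, every edge label `c₀ + Σ cₓ x` (coefficients in `R`)
  becomes the `β × β` block of affine forms `ρ(c₀) + Σ ρ(cₓ) x`, `ρ = Algebra.leftMulMatrix b` the
  regular representation (`ρ(c)_{ij} = (b.repr (c · b_j))_i`); a new source feeds `(s, i)` with the
  constant `λ(b_i)` and every `(t, j)` feeds a new sink with the `j`-th coordinate of `1_R`; since
  `ρ` is a ring homomorphism the `((s,i),(t,j))` path sum of the blown-up program is
  `ρ(P)_{ij}` coefficientwise (`blowup_pow`), and `λ(c) = Σ_{ij} λ(b_i) ρ(c)_{ij} (b.repr 1)_j`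
  (`linear_readout`) turns the bordered path sum into `λ(P)` coefficientwise.

The coefficientwise maps are written with Mathlib's `AddMonoidAlgebra.map` (an `MvPolynomial` is an
`AddMonoidAlgebra`); the coefficient formula `coeff d (AddMonoidAlgebra.map f P) = f (coeff d P)` is
definitional (private `coeff_mapRange`; consumers use `rfl`). The algebraic core (`mapEntry_mul`,
`blowup_mul`, `blowup_pow`) is stated for an arbitrary ring homomorphism `ρ : R →+* Matrix β β F`;
the folklore plumbing lemmas are private.

Cell `val-lit`, seat p3 g6; theorem-only (no definitions, no named facts). Consumer: route
GrenetZeon item `TransferToDc` (an `(m, s)`-representation of `per_n` over a commutative coefficient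
algebra gives an ordinary affine determinantal representation). Honest framing: textbook linear
algebra about branching programs; nothing here bears on `VP` versus `VNP`.

## References

* P. Hrubeš, A. Yehudayoff, *Arithmetic complexity in ring extensions*, Theory of Computing 7
  (2011) 119–129, Thm. 1.1 and §4 (simulating an extension of dimension `r` by `r × r` matrices).
  [HrubesYehudayoff2011]
* R. Andrews, M. A. Forbes, STOC 2022 = arXiv:2112.00792, §3.2 (layered ABPs; substitution of
  affine forms in the proof of Lemma 3.7). [AndrewsForbes2022]
* P. Bürgisser, M. Clausen, M. A. Shokrollahi, *Algebraic Complexity Theory*, Springer 1997,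
  Thm. (21.27) (path sums of layered programs). [BurgisserClausenShokrollahi1997]
-/

noncomputable section

namespace Literature.Computability.AlgebraicComplexity

open MvPolynomial Finset
open _root_.Matrix

universe u v w

namespace LayeredABPComputes

/-! ## Affine substitution -/

section Aeval

variable {R : Type u} [CommRing R] {ι : Type v} {τ : Type w}

/-- **Affine substitution.** If `g` is computed by a layered ABP on at most `m` vertices and every
`φ i` is an affine form, then `aeval φ g` is computed by a layered ABP on at most `m` vertices (the
same graph with every label `ℓ_e` replaced by `ℓ_e ∘ φ`, still affine).
[cite: AndrewsForbes2022, §3.2 (Lemma 3.7, proof)] -/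
theorem aeval_affine {m : ℕ} {g : MvPolynomial ι R} (h : LayeredABPComputes m g)
    (φ : ι → MvPolynomial τ R) (hφ : ∀ i, (φ i).totalDegree ≤ 1) :
    LayeredABPComputes m (aeval φ g) := by
  obtain ⟨k, hk, layer, s, t, N, h1, h2, h3⟩ := h
  refine ⟨k, hk, layer, s, t, N.map (aeval φ), ?_, ?_, ?_⟩
  · intro u v huv
    refine h1 u v fun h0 => huv ?_
    rw [Matrix.map_apply, h0, map_zero]
  · intro u v
    rw [Matrix.map_apply]
    exact (HasDetRepr.totalDegree_aeval_le_of_le_one φ hφ _).trans (h2 u v)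
  · rw [← h3, ← AlgHom.mapMatrix_apply, ← map_pow, AlgHom.mapMatrix_apply, Matrix.map_apply]

end Aeval

/-! ## Coefficientwise maps -/

section Coefficientwise

variable {R : Type u} [CommRing R] {F : Type w} [CommRing F] {ι : Type v}

/-- Coefficients of an additive map applied coefficientwise (`AddMonoidAlgebra.map`); definitional.
[folklore] -/
private theorem coeff_mapRange (f : R →+ F) (p : MvPolynomial ι R) (d : ι →₀ ℕ) :
    coeff d (AddMonoidAlgebra.map f p : MvPolynomial ι F) = f (coeff d p) := rfl

/-- A coefficientwise map does not raise the total degree (its support can only shrink).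
[folklore] -/
private theorem totalDegree_mapRange_le (f : R →+ F) (p : MvPolynomial ι R) :
    MvPolynomial.totalDegree (AddMonoidAlgebra.map f p : MvPolynomial ι F) ≤ p.totalDegree := by
  rw [totalDegree, totalDegree]
  refine Finset.sup_mono fun d hd => ?_
  rw [mem_support_iff] at hd ⊢
  intro h0
  exact hd (by rw [coeff_mapRange, h0, map_zero])

/-- A coefficientwise map sends `0` to `0`. [folklore] -/
private theorem mapRange_zero (f : R →+ F) :
    (AddMonoidAlgebra.map f (0 : MvPolynomial ι R) : MvPolynomial ι F) = 0 :=
  MvPolynomial.ext _ _ fun d => by rw [coeff_mapRange, coeff_zero, coeff_zero, map_zero]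

/-- A coefficientwise map is additive. [folklore] -/
private theorem mapRange_add (f : R →+ F) (p q : MvPolynomial ι R) :
    (AddMonoidAlgebra.map f (p + q) : MvPolynomial ι F) =
      AddMonoidAlgebra.map f p + AddMonoidAlgebra.map f q :=
  MvPolynomial.ext _ _ fun d => by simp only [coeff_mapRange, coeff_add, map_add]

/-- A coefficientwise map commutes with finite sums. [folklore] -/
private theorem mapRange_sum (f : R →+ F) {α : Type*} (S : Finset α) (p : α → MvPolynomial ι R) :
    (AddMonoidAlgebra.map f (∑ a ∈ S, p a) : MvPolynomial ι F) =
      ∑ a ∈ S, (AddMonoidAlgebra.map f (p a) : MvPolynomial ι F) :=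
  MvPolynomial.ext _ _ fun d => by simp only [coeff_mapRange, coeff_sum, map_sum]

/-- A constant goes to a constant. [folklore] -/
private theorem mapRange_C (f : R →+ F) (c : R) :
    (AddMonoidAlgebra.map f (C c : MvPolynomial ι R) : MvPolynomial ι F) = C (f c) :=
  MvPolynomial.ext _ _ fun d => by
    classical
    simp only [coeff_mapRange, coeff_C]
    split_ifs
    · rfl
    · rw [map_zero]

end Coefficientwise

/-! ## Matrix coefficients: the entries of a ring homomorphism into matrices, coefficientwise -/

section MatrixCoefficients

variable {R : Type u} [CommRing R] {F : Type w} [CommRing F] {ι : Type v}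
variable {β : Type} [Fintype β] [DecidableEq β] (ρ : R →+* Matrix β β F)

/-- Multiplicativity of the matrix of coefficientwise entries: for a ring homomorphism
`ρ : R → Matrix β β F`, the `(i,j)` entry of `ρ` applied coefficientwise to `p q` is
`Σ_k ρ(p)_{ik} ρ(q)_{kj}` (Cauchy product and `ρ(xy) = ρ(x) ρ(y)`).
[cite: HrubesYehudayoff2011, §4 (simulation of the extension by matrices)] -/
theorem mapEntry_mul (i j : β) (p q : MvPolynomial ι R) :
    (AddMonoidAlgebra.map ((Matrix.entryAddMonoidHom F i j).comp ρ.toAddMonoidHom) (p * q) :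
        MvPolynomial ι F) =
      ∑ k, (AddMonoidAlgebra.map ((Matrix.entryAddMonoidHom F i k).comp ρ.toAddMonoidHom) p :
          MvPolynomial ι F) *
        (AddMonoidAlgebra.map ((Matrix.entryAddMonoidHom F k j).comp ρ.toAddMonoidHom) q :
          MvPolynomial ι F) := by
  classical
  refine MvPolynomial.ext _ _ fun d => ?_
  simp only [coeff_mapRange, coeff_sum, coeff_mul, AddMonoidHom.coe_comp, Function.comp_apply,
    RingHom.toAddMonoidHom_eq_coe, AddMonoidHom.coe_coe, Matrix.entryAddMonoidHom_apply, map_sum,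
    map_mul, Matrix.mul_apply]
  exact Finset.sum_comm

/-- The unit goes to the identity matrix, entrywise and coefficientwise. [folklore] -/
private theorem mapEntry_one (i j : β) :
    (AddMonoidAlgebra.map ((Matrix.entryAddMonoidHom F i j).comp ρ.toAddMonoidHom)
        (1 : MvPolynomial ι R) : MvPolynomial ι F) = (1 : Matrix β β (MvPolynomial ι F)) i j := by
  classical
  refine MvPolynomial.ext _ _ fun d => ?_
  simp only [coeff_mapRange, coeff_one, AddMonoidHom.coe_comp, Function.comp_apply,
    RingHom.toAddMonoidHom_eq_coe, AddMonoidHom.coe_coe, Matrix.entryAddMonoidHom_apply]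
  by_cases hij : i = j
  · subst hij
    simp only [Matrix.one_apply_eq, coeff_one]
    split_ifs
    · rw [map_one, Matrix.one_apply_eq]
    · rw [map_zero, Matrix.zero_apply]
  · simp only [Matrix.one_apply_ne hij, coeff_zero]
    split_ifs
    · rw [map_one, Matrix.one_apply_ne hij]
    · rw [map_zero, Matrix.zero_apply]

variable {k : ℕ}

/-- **Block blow-up of a product.** Replacing every entry of a matrix over `R[x]` by the `β × β`
block of its coefficientwise `ρ`-entries is multiplicative.
[cite: HrubesYehudayoff2011, §4 (simulation of the extension by matrices)] -/
theorem blowup_mul (N₁ N₂ : Matrix (Fin k) (Fin k) (MvPolynomial ι R)) :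
    (Matrix.of fun x y : Fin k × β =>
        (AddMonoidAlgebra.map ((Matrix.entryAddMonoidHom F x.2 y.2).comp ρ.toAddMonoidHom)
          ((N₁ * N₂) x.1 y.1) : MvPolynomial ι F)) =
      (Matrix.of fun x y : Fin k × β =>
        (AddMonoidAlgebra.map ((Matrix.entryAddMonoidHom F x.2 y.2).comp ρ.toAddMonoidHom)
          (N₁ x.1 y.1) : MvPolynomial ι F)) *
      (Matrix.of fun x y : Fin k × β =>
        (AddMonoidAlgebra.map ((Matrix.entryAddMonoidHom F x.2 y.2).comp ρ.toAddMonoidHom)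
          (N₂ x.1 y.1) : MvPolynomial ι F)) := by
  refine Matrix.ext fun x z => ?_
  simp only [Matrix.of_apply, Matrix.mul_apply]
  rw [mapRange_sum, Fintype.sum_prod_type]
  exact Finset.sum_congr rfl fun v _ => mapEntry_mul ρ x.2 z.2 _ _

/-- **Block blow-up of the identity** is the identity. [folklore] -/
private theorem blowup_one :
    (Matrix.of fun x y : Fin k × β =>
        (AddMonoidAlgebra.map ((Matrix.entryAddMonoidHom F x.2 y.2).comp ρ.toAddMonoidHom)
          ((1 : Matrix (Fin k) (Fin k) (MvPolynomial ι R)) x.1 y.1) : MvPolynomial ι F)) = 1 := by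
  refine Matrix.ext fun x y => ?_
  rw [Matrix.of_apply]
  by_cases h1 : x.1 = y.1
  · rw [h1, Matrix.one_apply_eq, mapEntry_one]
    by_cases h2 : x.2 = y.2
    · have hxy : x = y := Prod.ext h1 h2
      rw [h2, Matrix.one_apply_eq, hxy, Matrix.one_apply_eq]
    · have hxy : x ≠ y := fun h => h2 (congrArg Prod.snd h)
      rw [Matrix.one_apply_ne h2, Matrix.one_apply_ne hxy]
  · have hxy : x ≠ y := fun h => h1 (congrArg Prod.fst h)
    rw [Matrix.one_apply_ne h1, mapRange_zero, Matrix.one_apply_ne hxy]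

/-- **Block blow-up of a power**: the `((x₁,i),(y₁,j))` entry of the `L`-th power of the blown-up
matrix is the coefficientwise `(i,j)` entry of `ρ` applied to `(N ^ L) x₁ y₁` — the path sums of the
blown-up program simulate those of the program over `R`.
[cite: HrubesYehudayoff2011, §4 (simulation of the extension by matrices)] -/
theorem blowup_pow (N : Matrix (Fin k) (Fin k) (MvPolynomial ι R)) (L : ℕ) :
    (Matrix.of fun x y : Fin k × β =>
        (AddMonoidAlgebra.map ((Matrix.entryAddMonoidHom F x.2 y.2).comp ρ.toAddMonoidHom)
          (N x.1 y.1) : MvPolynomial ι F)) ^ L =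
      Matrix.of fun x y : Fin k × β =>
        (AddMonoidAlgebra.map ((Matrix.entryAddMonoidHom F x.2 y.2).comp ρ.toAddMonoidHom)
          ((N ^ L) x.1 y.1) : MvPolynomial ι F) := by
  induction L with
  | zero => rw [pow_zero, pow_zero, blowup_one]
  | succ L ih => rw [pow_succ, pow_succ, ih, blowup_mul]

end MatrixCoefficients

/-! ## Restriction of scalars along a basis -/

section Restrict

variable {F : Type w} [CommRing F] {R : Type u} [CommRing R] [Algebra F R] {ι : Type v}
variable {β : Type} [Fintype β] [DecidableEq β]

/-- **The linear read-out through the regular representation**: for an `F`-linear `λ : R → F`,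
`λ(c) = Σ_{i,j} λ(b_i) · ρ(c)_{ij} · (b.repr 1)_j` with `ρ = leftMulMatrix b`
(`c = c · 1 = Σ_j (b.repr 1)_j c b_j = Σ_{ij} (b.repr 1)_j ρ(c)_{ij} b_i`). [folklore] -/
private theorem linear_readout (b : Module.Basis β F R) (l : R →ₗ[F] F) (c : R) :
    l c = ∑ i, ∑ j, l (b i) * (Algebra.leftMulMatrix b c i j * b.repr 1 j) := by
  have hc : c = ∑ i, (∑ j, Algebra.leftMulMatrix b c i j * b.repr 1 j) • b i := by
    have h1 : ∀ i, (∑ j, Algebra.leftMulMatrix b c i j * b.repr 1 j) = b.repr c i := by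
      intro i
      have := congrFun (Algebra.leftMulMatrix_mulVec_repr b c 1) i
      rw [mul_one] at this
      rw [← this, Matrix.mulVec, dotProduct]
    simp_rw [h1]
    exact (b.sum_repr c).symm
  conv_lhs => rw [hc]
  rw [map_sum]
  refine Finset.sum_congr rfl fun i _ => ?_
  rw [map_smul, smul_eq_mul, Finset.sum_mul]
  refine Finset.sum_congr rfl fun j _ => ?_
  ring

/-- **Restriction of scalars (regular-representation unrolling) for layered ABPs.** Let `R` be a
commutative `F`-algebra with a finite `F`-basis `b` indexed by `β`, `λ : R → F` an `F`-linear
functional, and `P ∈ R[x]` computed by a layered ABP on at most `m` vertices over `R`. Then `λ`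
applied coefficientwise to `P` is computed by a layered ABP on at most `m · |β| + 2` vertices over
`F`: blow every vertex up into a `β`-block and every affine label into the `β × β` block of affine
forms given by the regular representation `ρ = leftMulMatrix b` coefficientwise, add a source feeding
`(s, i)` with the constant `λ(b_i)` and a sink fed by `(t, j)` with the constant `(b.repr 1)_j`
(Hrubeš–Yehudayoff: an extension of rank `r` is simulated by `r × r` matrices; for branching
programs the simulation is exact and the width grows by the factor `r`).
[cite: HrubesYehudayoff2011, Thm. 1.1 and §4] -/
theorem restrictScalars (b : Module.Basis β F R) {m : ℕ} {P : MvPolynomial ι R}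
    (h : LayeredABPComputes m P) (l : R →ₗ[F] F) :
    LayeredABPComputes (m * Fintype.card β + 2)
      (AddMonoidAlgebra.map l.toAddMonoidHom P : MvPolynomial ι F) := by
  classical
  obtain ⟨k, hk, layer, s, t, N, hlay, hdeg, hP⟩ := h
  -- the regular representation, coefficientwise and entrywise
  set ρ : R →+* Matrix β β F := (Algebra.leftMulMatrix b).toRingHom with hρ
  -- the blown-up adjacency matrix and its bordering by a source `inr 0` and a sink `inr 1`
  let B : Matrix (Fin k × β) (Fin k × β) (MvPolynomial ι F) := Matrix.of fun x y =>
    (AddMonoidAlgebra.map ((Matrix.entryAddMonoidHom F x.2 y.2).comp ρ.toAddMonoidHom) (N x.1 y.1) :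
      MvPolynomial ι F)
  let A : Matrix ((Fin k × β) ⊕ Fin 2) ((Fin k × β) ⊕ Fin 2) (MvPolynomial ι F) :=
    Matrix.of fun p q =>
      match p, q with
      | Sum.inl x, Sum.inl y => B x y
      | Sum.inr e, Sum.inl y => if e = 0 ∧ y.1 = s then C (l (b y.2)) else 0
      | Sum.inl x, Sum.inr e => if e = 1 ∧ x.1 = t then C (b.repr 1 x.2) else 0
      | Sum.inr _, Sum.inr _ => 0
  let layer' : (Fin k × β) ⊕ Fin 2 → ℕ :=
    Sum.elim (fun x => layer x.1 + 1) (fun e => if e = 0 then layer s else layer t + 2)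
  have hA_inl_inl : ∀ x y, A (Sum.inl x) (Sum.inl y) = B x y := fun _ _ => rfl
  have hA_inl_inr : ∀ (x : Fin k × β) (e : Fin 2),
      A (Sum.inl x) (Sum.inr e) = if e = 1 ∧ x.1 = t then C (b.repr 1 x.2) else 0 :=
    fun _ _ => rfl
  have hA_inr_inl : ∀ (e : Fin 2) (y : Fin k × β),
      A (Sum.inr e) (Sum.inl y) = if e = 0 ∧ y.1 = s then C (l (b y.2)) else 0 :=
    fun _ _ => rfl
  have hA_inr_inr : ∀ e e' : Fin 2, A (Sum.inr e) (Sum.inr e') = 0 := fun _ _ => rfl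
  have hA_src : ∀ y : Fin k × β,
      A (Sum.inr 0) (Sum.inl y) = if y.1 = s then C (l (b y.2)) else 0 := by
    intro y; rw [hA_inr_inl]; simp only [true_and]
  have hA_snk : ∀ x : Fin k × β,
      A (Sum.inl x) (Sum.inr 1) = if x.1 = t then C (b.repr 1 x.2) else 0 := by
    intro x; rw [hA_inl_inr]; simp only [true_and]
  have h01 : (0 : Fin 2) ≠ 1 := by decide
  have hA_to_src : ∀ p, A p (Sum.inr 0) = 0 := by
    rintro (x | e)
    · rw [hA_inl_inr, if_neg (fun h => h01 h.1)]
    · rfl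
  have hA_from_snk : ∀ q, A (Sum.inr 1) q = 0 := by
    rintro (y | e)
    · rw [hA_inr_inl, if_neg (fun h => h01 h.1.symm)]
    · rfl
  -- layered
  have hB_lay : ∀ x y, B x y ≠ 0 → layer y.1 = layer x.1 + 1 := by
    intro x y hxy
    refine hlay x.1 y.1 fun h0 => hxy ?_
    simp only [B, Matrix.of_apply, h0, mapRange_zero]
  have hA_lay : ∀ p q, A p q ≠ 0 → layer' q = layer' p + 1 := by
    rintro (x | e) (y | e') hne
    · have := hB_lay x y hne
      simp only [layer', Sum.elim_inl, this]
    · rw [hA_inl_inr] at hne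
      have h : e' = 1 ∧ x.1 = t := by by_contra h; exact hne (if_neg h)
      obtain ⟨rfl, hx⟩ := h
      show (if (1 : Fin 2) = 0 then layer s else layer t + 2) = layer x.1 + 1 + 1
      rw [if_neg h01.symm, hx]
    · rw [hA_inr_inl] at hne
      have h : e = 0 ∧ y.1 = s := by by_contra h; exact hne (if_neg h)
      obtain ⟨rfl, hy⟩ := h
      show layer y.1 + 1 = (if (0 : Fin 2) = 0 then layer s else layer t + 2) + 1
      rw [if_pos rfl, hy]
    · exact absurd (hA_inr_inr e e') hne
  -- affine labels
  have hdeg0 : (0 : MvPolynomial ι F).totalDegree ≤ 1 := by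
    rw [totalDegree_zero]; exact Nat.zero_le _
  have hA_deg : ∀ p q, (A p q).totalDegree ≤ 1 := by
    rintro (x | e) (y | e')
    · rw [hA_inl_inl]
      exact (totalDegree_mapRange_le _ _).trans (hdeg x.1 y.1)
    · rw [hA_inl_inr]
      split_ifs
      · rw [totalDegree_C]; exact Nat.zero_le _
      · exact hdeg0
    · rw [hA_inr_inl]
      split_ifs
      · rw [totalDegree_C]; exact Nat.zero_le _
      · exact hdeg0
    · rw [hA_inr_inr]; exact hdeg0
  -- the program
  have hprog := layeredABPComputes_of_fintype (R := F) (ι := ι) (V := (Fin k × β) ⊕ Fin 2)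
    (m := m * Fintype.card β + 2)
    (by
      rw [Fintype.card_sum, Fintype.card_prod, Fintype.card_fin, Fintype.card_fin]
      exact Nat.add_le_add_right (Nat.mul_le_mul_right _ hk) 2)
    layer' (Sum.inr 0) (Sum.inr 1) A hA_lay hA_deg
  -- its value: first, the inner block of every power is the blow-up of the power
  have hpow_inl_src : ∀ (L : ℕ) (x : Fin k × β), (A ^ L) (Sum.inl x) (Sum.inr 0) = 0 := by
    intro L
    induction L with
    | zero => intro x; rw [pow_zero]; exact Matrix.one_apply_ne (by simp)
    | succ L ih =>
      intro x
      rw [pow_succ, Matrix.mul_apply]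
      exact Finset.sum_eq_zero fun p _ => by rw [hA_to_src, mul_zero]
  have hpow_inl_inl : ∀ (L : ℕ) (x y : Fin k × β),
      (A ^ L) (Sum.inl x) (Sum.inl y) = (B ^ L) x y := by
    intro L
    induction L with
    | zero =>
      intro x y
      rw [pow_zero, pow_zero]
      by_cases hxy : x = y
      · subst hxy; rw [Matrix.one_apply_eq, Matrix.one_apply_eq]
      · rw [Matrix.one_apply_ne hxy, Matrix.one_apply_ne (fun h => hxy (Sum.inl_injective h))]
    | succ L ih =>
      intro x y
      rw [pow_succ, pow_succ, Matrix.mul_apply, Matrix.mul_apply, Fintype.sum_sum_type,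
        Fin.sum_univ_two, hpow_inl_src, zero_mul, hA_from_snk, mul_zero, add_zero, add_zero]
      exact Finset.sum_congr rfl fun z _ => by rw [ih, hA_inl_inl]
  have hBpow : ∀ L : ℕ, B ^ L = Matrix.of fun x y : Fin k × β =>
      (AddMonoidAlgebra.map ((Matrix.entryAddMonoidHom F x.2 y.2).comp ρ.toAddMonoidHom)
        ((N ^ L) x.1 y.1) : MvPolynomial ι F) := fun L => blowup_pow ρ N L
  -- the value of the bordered program is `λ` coefficientwise of `P`
  have hval : (A ^ (layer' (Sum.inr 1) - layer' (Sum.inr 0))) (Sum.inr 0) (Sum.inr 1) =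
      (AddMonoidAlgebra.map l.toAddMonoidHom P : MvPolynomial ι F) := by
    have hl1 : layer' (Sum.inr 1) = layer t + 2 := by simp [layer']
    have hl0 : layer' (Sum.inr 0) = layer s := by simp [layer']
    rw [hl1, hl0]
    rcases le_or_gt (layer s) (layer t) with hst | hts
    · -- the generic case: paths source → (s,i) → ⋯ → (t,j) → sink
      obtain ⟨L, hL⟩ := Nat.exists_eq_add_of_le hst
      have hLst : layer t - layer s = L := by omega
      have hexp : layer t + 2 - layer s = L + 1 + 1 := by omega
      -- after `L + 1` edges from the source one sits at an inner vertex
      have hsrc_pow : ∀ y : Fin k × β, (A ^ (L + 1)) (Sum.inr 0) (Sum.inl y) =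
          ∑ x : Fin k × β, A (Sum.inr 0) (Sum.inl x) * (B ^ L) x y := by
        intro y
        rw [pow_succ', Matrix.mul_apply, Fintype.sum_sum_type, Fin.sum_univ_two, hA_inr_inr,
          hA_inr_inr, zero_mul, zero_mul, add_zero, add_zero]
        exact Finset.sum_congr rfl fun x _ => by rw [hpow_inl_inl]
      -- closed form of the source-to-sink entry
      have hclosed : (A ^ (L + 1 + 1)) (Sum.inr 0) (Sum.inr 1) =
          ∑ i : β, ∑ j : β, C (l (b i)) * (B ^ L) (s, i) (t, j) * C (b.repr 1 j) := by
        rw [pow_succ, Matrix.mul_apply, Fintype.sum_sum_type, Fin.sum_univ_two, hA_inr_inr,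
          hA_inr_inr, mul_zero, mul_zero, add_zero, add_zero]
        simp_rw [hsrc_pow, hA_src, hA_snk]
        rw [Fintype.sum_prod_type]
        dsimp only
        rw [Finset.sum_eq_single_of_mem t (Finset.mem_univ _)
          (fun y₁ _ hy₁ => Finset.sum_eq_zero fun y₂ _ => by rw [if_neg hy₁, mul_zero])]
        simp only [if_true]
        rw [Finset.sum_comm]
        refine Finset.sum_congr rfl fun j _ => ?_
        rw [Fintype.sum_prod_type]
        dsimp only
        rw [Finset.sum_eq_single_of_mem s (Finset.mem_univ _)
          (fun x₁ _ hx₁ => Finset.sum_eq_zero fun x₂ _ => by rw [if_neg hx₁, zero_mul]),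
          Finset.sum_mul]
        simp only [if_true]
      rw [hexp, hclosed]
      -- compare coefficients
      refine MvPolynomial.ext _ _ fun d => ?_
      rw [coeff_mapRange, LinearMap.toAddMonoidHom_coe, ← hP, hLst, linear_readout b l,
        coeff_sum]
      refine Finset.sum_congr rfl fun i _ => ?_
      rw [coeff_sum]
      refine Finset.sum_congr rfl fun j _ => ?_
      rw [mul_comm _ (C _), ← mul_assoc, ← C_mul, coeff_C_mul, hBpow L, Matrix.of_apply, coeff_mapRange]
      have hentry : ((Matrix.entryAddMonoidHom F (s, i).2 (t, j).2).comp ρ.toAddMonoidHom)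
          (coeff d ((N ^ L) (s, i).1 (t, j).1)) = Algebra.leftMulMatrix b (coeff d ((N ^ L) s t)) i j :=
        rfl
      rw [hentry]
      ring
    · -- degenerate case `ℓ(t) < ℓ(s)`: then `s ≠ t`, `P = 0`, and the bordered exponent is `≤ 1`
      have hst : s ≠ t := by rintro rfl; exact lt_irrefl _ hts
      have hP0 : P = 0 := by
        rw [← hP, Nat.sub_eq_zero_of_le hts.le, pow_zero, Matrix.one_apply_ne hst]
      rw [hP0, mapRange_zero]
      rcases Nat.lt_or_ge (layer t + 2) (layer s + 1) with h2 | h2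
      · rw [Nat.sub_eq_zero_of_le (by omega), pow_zero]
        exact Matrix.one_apply_ne (by simp)
      · have : layer t + 2 - layer s = 1 := by omega
        rw [this, pow_one, hA_inr_inr]
  rwa [hval] at hprog

end Restrict

end LayeredABPComputes

end Literature.Computability.AlgebraicComplexity
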